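import Mathlib
import Summits.MatrixMultiplication.MatrixMultiplication.Theorems.SoloBlindNetworkStructure

set_option linter.dupNamespace false

/-!
SOLO-BLIND MatrixMultiplication (s72) — SLICE CALCULUS for ML-orthogonal weight functions on `𝔽₃ⁿ⁺¹`
(KraftK3 §7.13; the algebraic identities behind the Defect-0 Tree Theorem K3.13.2 and the network calculus Q-K19).

For a weight function `ν : 𝔽₃ⁿ⁺¹ → 𝔽₃` write `ν_t := slice ν t` for its restriction to `{x_0 = t}`, read on `𝔽₃ⁿ`.
If `ν` is orthogonal to all multilinear monomials (`MLOrthogonal ν`, equivalently a line network by the Network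
Structure Theorem of `SoloBlindNetworkStructure`), then:
* (S1/S2) `ν_0 + ν_1 + ν_2` and `ν_1 + 2ν_2` are ML-orthogonal on `𝔽₃ⁿ`;
* (S3) every difference `ν_s − ν_t` is ML-orthogonal on `𝔽₃ⁿ`;
* (S4) the three slice totals coincide, each equal to `−σ_0(ν)` with `σ_0(ν) = Σ_x ν(x) x_0²` — so `σ_0 ≠ 0` forces all
  three slices to be non-empty;
* (S5) if one slice vanishes identically, every slice is ML-orthogonal by itself (the function splits into independent
  networks living in two parallel hyperplanes);
* (S6) LEAF PEELING (algebraic half): if the `t`-slice is supported on one point `p'`, subtracting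
  `ν(t,p') · 𝟙[axis line through (t,p') in direction 0]` empties the `t`-slice, and the two remaining slices are then
  ML-orthogonal weight functions on `𝔽₃ⁿ` in their own right;
* every weight function is the sum of its three pushed slices (reassembly).
All statements are unconditional finite linear algebra over `𝔽₃`.
-/

namespace Summit.MatrixMultiplication.MatrixMultiplication.Theorems

open Finset

/-- The slice `{x_0 = t}` of a weight function on `𝔽₃ⁿ⁺¹`, read as a weight function on `𝔽₃ⁿ`. -/
def slice {n : ℕ} (ν : (Fin (n + 1) → ZMod 3) → ZMod 3) (t : ZMod 3) : (Fin n → ZMod 3) → ZMod 3 :=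
  fun x' => ν (Fin.cons t x')

/-- Pointwise formula for `slice`. -/
theorem slice_apply {n : ℕ} (ν : (Fin (n + 1) → ZMod 3) → ZMod 3) (t : ZMod 3) (x' : Fin n → ZMod 3) :
    slice ν t x' = ν (Fin.cons t x') := rfl

/-- The diagonal second moment in direction `0`: `σ_0(ν) = Σ_x ν(x) · x_0²`. -/
def sigma0 {n : ℕ} (ν : (Fin (n + 1) → ZMod 3) → ZMod 3) : ZMod 3 := ∑ x, ν x * (x 0) ^ 2

/-! ## Closure properties of ML-orthogonality -/

/-- The zero weight function is ML-orthogonal. -/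
theorem MLOrthogonal.zero {n : ℕ} : MLOrthogonal (0 : (Fin n → ZMod 3) → ZMod 3) := by
  intro T
  simp

/-- ML-orthogonality is preserved by negation. -/
theorem MLOrthogonal.neg {n : ℕ} {ν : (Fin n → ZMod 3) → ZMod 3} (hν : MLOrthogonal ν) : MLOrthogonal (-ν) := by
  have h := hν.smul (-1)
  rwa [neg_one_smul] at h

/-- ML-orthogonality is preserved by differences. -/
theorem MLOrthogonal.sub {n : ℕ} {ν μ : (Fin n → ZMod 3) → ZMod 3} (hν : MLOrthogonal ν) (hμ : MLOrthogonal μ) :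
    MLOrthogonal (ν - μ) := by
  rw [sub_eq_add_neg]
  exact hν.add hμ.neg

/-! ## Slice relations -/

/-- (S1) The sum of the three slices of an ML-orthogonal weight function is ML-orthogonal on `𝔽₃ⁿ`. -/
theorem slice_sum_mlOrthogonal {n : ℕ} {ν : (Fin (n + 1) → ZMod 3) → ZMod 3} (hν : MLOrthogonal ν) :
    MLOrthogonal (slice ν 0 + slice ν 1 + slice ν 2) := by
  intro T
  have h := hν (T.map (Fin.succEmb n))
  rw [sum_cons_split] at h
  simp only [mlMonomial_map_succ] at h
  rw [sum_univ_zmod3] at h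
  simpa [slice, Pi.add_apply, add_mul, Finset.sum_add_distrib] using h

/-- (S2) The weighted slice combination `ν_1 + 2ν_2` (that is, `Σ_t t·ν_t`) is ML-orthogonal on `𝔽₃ⁿ`. -/
theorem slice_weighted_mlOrthogonal {n : ℕ} {ν : (Fin (n + 1) → ZMod 3) → ZMod 3} (hν : MLOrthogonal ν) :
    MLOrthogonal (slice ν 1 + (2 : ZMod 3) • slice ν 2) := by
  intro T
  have h := hν (insert 0 (T.map (Fin.succEmb n)))
  rw [sum_cons_split] at h
  simp only [mlMonomial_insert_zero] at h
  rw [sum_univ_zmod3] at h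
  simp only [zero_mul, mul_zero, Finset.sum_const_zero, zero_add, one_mul] at h
  have e : ∀ x', (slice ν 1 + (2 : ZMod 3) • slice ν 2) x' * mlMonomial T x'
      = ν (Fin.cons 1 x') * mlMonomial T x' + ν (Fin.cons 2 x') * (2 * mlMonomial T x') := by
    intro x'
    simp only [Pi.add_apply, Pi.smul_apply, smul_eq_mul, slice]
    ring
  rw [Finset.sum_congr rfl (fun x' _ => e x'), Finset.sum_add_distrib]
  exact h

/-- (S3, generators) `ν_1 − ν_0` is ML-orthogonal. -/
theorem slice_one_sub_zero_mlOrthogonal {n : ℕ} {ν : (Fin (n + 1) → ZMod 3) → ZMod 3} (hν : MLOrthogonal ν) :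
    MLOrthogonal (slice ν 1 - slice ν 0) := by
  have idα : ∀ a b c : ZMod 3, b - a = 2 * (a + b + c) + 2 * (b + 2 * c) := by decide
  have e : (slice ν 1 - slice ν 0)
      = (2 : ZMod 3) • (slice ν 0 + slice ν 1 + slice ν 2) + (2 : ZMod 3) • (slice ν 1 + (2 : ZMod 3) • slice ν 2) := by
    funext x'
    simp only [Pi.sub_apply, Pi.add_apply, Pi.smul_apply, smul_eq_mul]
    exact idα _ _ _
  rw [e]
  exact ((slice_sum_mlOrthogonal hν).smul 2).add ((slice_weighted_mlOrthogonal hν).smul 2)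

/-- (S3, generators) `ν_2 − ν_0` is ML-orthogonal. -/
theorem slice_two_sub_zero_mlOrthogonal {n : ℕ} {ν : (Fin (n + 1) → ZMod 3) → ZMod 3} (hν : MLOrthogonal ν) :
    MLOrthogonal (slice ν 2 - slice ν 0) := by
  have idβ : ∀ a b c : ZMod 3, c - a = 2 * (a + b + c) + (b + 2 * c) := by decide
  have e : (slice ν 2 - slice ν 0)
      = (2 : ZMod 3) • (slice ν 0 + slice ν 1 + slice ν 2) + (slice ν 1 + (2 : ZMod 3) • slice ν 2) := by
    funext x'
    simp only [Pi.sub_apply, Pi.add_apply, Pi.smul_apply, smul_eq_mul]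
    exact idβ _ _ _
  rw [e]
  exact ((slice_sum_mlOrthogonal hν).smul 2).add (slice_weighted_mlOrthogonal hν)

/-- (S3) SLICE DIFFERENCES: for an ML-orthogonal weight function on `𝔽₃ⁿ⁺¹`, every difference of two slices is an
ML-orthogonal weight function on `𝔽₃ⁿ` (hence a line network one dimension down). -/
theorem slice_sub_mlOrthogonal {n : ℕ} {ν : (Fin (n + 1) → ZMod 3) → ZMod 3} (hν : MLOrthogonal ν) (s t : ZMod 3) :
    MLOrthogonal (slice ν s - slice ν t) := by
  have h10 := slice_one_sub_zero_mlOrthogonal hν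
  have h20 := slice_two_sub_zero_mlOrthogonal hν
  have h21 : MLOrthogonal (slice ν 2 - slice ν 1) := by
    have h := h20.sub h10
    rwa [sub_sub_sub_cancel_right] at h
  rcases zmod3_cases s with rfl | rfl | rfl <;> rcases zmod3_cases t with rfl | rfl | rfl
  · rw [sub_self]; exact MLOrthogonal.zero
  · rw [← neg_sub]; exact h10.neg
  · rw [← neg_sub]; exact h20.neg
  · exact h10
  · rw [sub_self]; exact MLOrthogonal.zero
  · rw [← neg_sub]; exact h21.neg
  · exact h20
  · exact h21
  · rw [sub_self]; exact MLOrthogonal.zero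

/-- (S4) SLICE TOTALS COINCIDE: the three slices of an ML-orthogonal weight function have the same total weight. -/
theorem slice_total_eq {n : ℕ} {ν : (Fin (n + 1) → ZMod 3) → ZMod 3} (hν : MLOrthogonal ν) (s t : ZMod 3) :
    ∑ x', slice ν s x' = ∑ x', slice ν t x' := by
  have h := slice_sub_mlOrthogonal hν s t ∅
  simp only [mlMonomial, Finset.prod_empty, mul_one, Pi.sub_apply, Finset.sum_sub_distrib] at h
  exact sub_eq_zero.mp h

/-- (S4') Each slice total equals `−σ_0(ν)`; in particular `σ_0(ν) ≠ 0` forces every slice of `ν` to be non-zero. -/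
theorem slice_total_eq_neg_sigma0 {n : ℕ} {ν : (Fin (n + 1) → ZMod 3) → ZMod 3} (hν : MLOrthogonal ν) (t : ZMod 3) :
    ∑ x', slice ν t x' = -sigma0 ν := by
  have hS : ∀ s : ZMod 3, ∑ x', ν (Fin.cons s x') = ∑ x', ν (Fin.cons 0 x') := fun s => slice_total_eq hν s 0
  have h4 : ∀ x' : Fin n → ZMod 3, ν (Fin.cons 2 x') * (Fin.cons 2 x' : Fin (n + 1) → ZMod 3) 0 ^ 2 = ν (Fin.cons 2 x') := by
    intro x'
    rw [Fin.cons_zero, show ((2 : ZMod 3) ^ 2) = 1 from by decide, mul_one]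
  have h1 : ∀ x' : Fin n → ZMod 3, ν (Fin.cons 1 x') * (Fin.cons 1 x' : Fin (n + 1) → ZMod 3) 0 ^ 2 = ν (Fin.cons 1 x') := by
    intro x'
    rw [Fin.cons_zero, one_pow, mul_one]
  have h0 : ∀ x' : Fin n → ZMod 3, ν (Fin.cons 0 x') * (Fin.cons 0 x' : Fin (n + 1) → ZMod 3) 0 ^ 2 = 0 := by
    intro x'
    rw [Fin.cons_zero, show ((0 : ZMod 3) ^ 2) = 0 from by decide, mul_zero]
  unfold sigma0
  rw [sum_cons_split, sum_univ_zmod3]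
  simp only [h0, h1, h4, Finset.sum_const_zero, zero_add]
  show ∑ x', ν (Fin.cons t x') = -(∑ x', ν (Fin.cons 1 x') + ∑ x', ν (Fin.cons 2 x'))
  rw [hS t, hS 1, hS 2]
  have e : ∀ a : ZMod 3, a = -(a + a) := by decide
  exact e _

/-- (S4'') Hence a slice with vanishing total forces `σ_0(ν) = 0`; contrapositively `σ_0(ν) ≠ 0` makes every slice non-zero. -/
theorem slice_ne_zero_of_sigma0_ne_zero {n : ℕ} {ν : (Fin (n + 1) → ZMod 3) → ZMod 3} (hν : MLOrthogonal ν)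
    (hσ : sigma0 ν ≠ 0) (t : ZMod 3) : slice ν t ≠ 0 := by
  intro ht
  have h := slice_total_eq_neg_sigma0 hν t
  rw [ht] at h
  simp only [Pi.zero_apply, Finset.sum_const_zero] at h
  exact hσ (neg_eq_zero.mp h.symm)

/-- (S5) EMPTY-SLICE SPLITTING: if one slice of an ML-orthogonal weight function vanishes identically, then every slice is
ML-orthogonal on its own. -/
theorem slice_mlOrthogonal_of_slice_eq_zero {n : ℕ} {ν : (Fin (n + 1) → ZMod 3) → ZMod 3} (hν : MLOrthogonal ν)
    {t : ZMod 3} (ht : slice ν t = 0) (s : ZMod 3) : MLOrthogonal (slice ν s) := by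
  have h := slice_sub_mlOrthogonal hν s t
  rwa [ht, sub_zero] at h

/-! ## Reassembly and leaf peeling -/

/-- Every weight function on `𝔽₃ⁿ⁺¹` is the sum of its three pushed slices. -/
theorem eq_sum_slicePush {n : ℕ} (μ : (Fin (n + 1) → ZMod 3) → ZMod 3) :
    μ = slicePush n 0 (slice μ 0) + slicePush n 1 (slice μ 1) + slicePush n 2 (slice μ 2) := by
  funext x
  refine Fin.consCases (fun t x' => ?_) x
  simp only [Pi.add_apply, slicePush_apply, Fin.cons_zero, Fin.tail_cons, slice]
  rcases zmod3_cases t with rfl | rfl | rfl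
  · rw [if_pos rfl, if_neg (show ¬ ((0 : ZMod 3) = 1) by decide), if_neg (show ¬ ((0 : ZMod 3) = 2) by decide)]
    ring
  · rw [if_neg (show ¬ ((1 : ZMod 3) = 0) by decide), if_pos rfl, if_neg (show ¬ ((1 : ZMod 3) = 2) by decide)]
    ring
  · rw [if_neg (show ¬ ((2 : ZMod 3) = 0) by decide), if_neg (show ¬ ((2 : ZMod 3) = 1) by decide), if_pos rfl]
    ring

/-- The axis line in direction `0` through `(t, p')` does not depend on `t`. -/
theorem axisLine_cons_dir_zero {n : ℕ} (t : ZMod 3) (p' : Fin n → ZMod 3) :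
    axisLine (Fin.cons t p') 0 = axisLine (Fin.cons 0 p') 0 := by
  funext x
  unfold axisLine
  have key : (∀ i : Fin (n + 1), i ≠ 0 → x i = (Fin.cons t p' : Fin (n + 1) → ZMod 3) i) ↔
      (∀ i : Fin (n + 1), i ≠ 0 → x i = (Fin.cons 0 p' : Fin (n + 1) → ZMod 3) i) := by
    constructor
    · intro h i hi
      induction i using Fin.cases with
      | zero => exact absurd rfl hi
      | succ i => rw [Fin.cons_succ, h i.succ hi, Fin.cons_succ]
    · intro h i hi
      induction i using Fin.cases with
      | zero => exact absurd rfl hi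
      | succ i => rw [Fin.cons_succ, h i.succ hi, Fin.cons_succ]
  by_cases h : ∀ i : Fin (n + 1), i ≠ 0 → x i = (Fin.cons 0 p' : Fin (n + 1) → ZMod 3) i
  · rw [if_pos (key.mpr h), if_pos h]
  · rw [if_neg (fun h' => h (key.mp h')), if_neg h]

/-- Every slice of the axis line through `(t, p')` in direction `0` is the point mass at `p'`. -/
theorem slice_axisLine_cons_zero {n : ℕ} (t s : ZMod 3) (p' x' : Fin n → ZMod 3) :
    slice (axisLine (Fin.cons t p') 0) s x' = if x' = p' then 1 else 0 := by
  rw [slice_apply, axisLine_cons_dir_zero t p', axisLine_cons_zero_apply, Fin.tail_cons]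

/-- (S6) LEAF PEELING, algebraic half: if the `t`-slice of an ML-orthogonal `ν` is supported on the single point `p'`, then
`ν' := ν − ν(t,p') · 𝟙[axis line through (t,p') in direction 0]` is ML-orthogonal, its `t`-slice vanishes, and each of
its slices is an ML-orthogonal weight function on `𝔽₃ⁿ` (so `ν = ν(t,p')·𝟙_L + push(ν'_s) + push(ν'_u)` with two
independent lower-dimensional networks `ν'_s`, `ν'_u` — the first step of the Defect-0 Tree Theorem). -/
theorem peel_singleton_slice {n : ℕ} {ν : (Fin (n + 1) → ZMod 3) → ZMod 3} (hν : MLOrthogonal ν) (t : ZMod 3)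
    (p' : Fin n → ZMod 3) (hsupp : ∀ x', x' ≠ p' → slice ν t x' = 0) :
    MLOrthogonal (ν - ν (Fin.cons t p') • axisLine (Fin.cons t p') 0) ∧
    slice (ν - ν (Fin.cons t p') • axisLine (Fin.cons t p') 0) t = 0 ∧
    ∀ s, MLOrthogonal (slice (ν - ν (Fin.cons t p') • axisLine (Fin.cons t p') 0) s) := by
  have hML : MLOrthogonal (ν - ν (Fin.cons t p') • axisLine (Fin.cons t p') 0) :=
    hν.sub ((axisLine_mlOrthogonal _ 0).smul _)
  have hzero : slice (ν - ν (Fin.cons t p') • axisLine (Fin.cons t p') 0) t = 0 := by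
    funext x'
    have hx : slice (ν - ν (Fin.cons t p') • axisLine (Fin.cons t p') 0) t x'
        = slice ν t x' - ν (Fin.cons t p') * slice (axisLine (Fin.cons t p') 0) t x' := rfl
    rw [hx, slice_axisLine_cons_zero, Pi.zero_apply]
    by_cases h : x' = p'
    · rw [if_pos h, h, mul_one, slice_apply, sub_self]
    · rw [if_neg h, mul_zero, sub_zero]
      exact hsupp x' h
  exact ⟨hML, hzero, fun s => slice_mlOrthogonal_of_slice_eq_zero hML hzero s⟩

/-- (S6') The peeled function reassembles from its two surviving slices: with `ν'` as in `peel_singleton_slice` and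
`{t, s, u} = 𝔽₃`, `ν' = push_s(ν'_s) + push_u(ν'_u)`. Stated for a general weight function with a vanishing slice. -/
theorem eq_two_slicePush_of_slice_eq_zero {n : ℕ} (μ : (Fin (n + 1) → ZMod 3) → ZMod 3) {t : ZMod 3}
    (ht : slice μ t = 0) {s u : ZMod 3} (hs : s ≠ t) (hu : u ≠ t) (hsu : s ≠ u) :
    μ = slicePush n s (slice μ s) + slicePush n u (slice μ u) := by
  have h := eq_sum_slicePush μ
  rcases zmod3_cases t with rfl | rfl | rfl
  · rw [ht, map_zero, zero_add] at h
    rcases zmod3_cases s with rfl | rfl | rfl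
    · exact absurd rfl hs
    · rcases zmod3_cases u with rfl | rfl | rfl
      · exact absurd rfl hu
      · exact absurd rfl hsu
      · exact h
    · rcases zmod3_cases u with rfl | rfl | rfl
      · exact absurd rfl hu
      · exact h.trans (add_comm _ _)
      · exact absurd rfl hsu
  · rw [ht, map_zero, add_zero] at h
    rcases zmod3_cases s with rfl | rfl | rfl
    · rcases zmod3_cases u with rfl | rfl | rfl
      · exact absurd rfl hsu
      · exact absurd rfl hu
      · exact h
    · exact absurd rfl hs
    · rcases zmod3_cases u with rfl | rfl | rfl
      · exact h.trans (add_comm _ _)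
      · exact absurd rfl hu
      · exact absurd rfl hsu
  · rw [ht, map_zero, add_zero] at h
    rcases zmod3_cases s with rfl | rfl | rfl
    · rcases zmod3_cases u with rfl | rfl | rfl
      · exact absurd rfl hsu
      · exact h
      · exact absurd rfl hu
    · rcases zmod3_cases u with rfl | rfl | rfl
      · exact h.trans (add_comm _ _)
      · exact absurd rfl hsu
      · exact absurd rfl hu
    · exact absurd rfl hs
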